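import Summits.BirchSwinnertonDyer.Rank1Residual.X12.O11.RamifiedRubinFormulaLine
import HarnessLib

set_option linter.dupNamespace false
set_option autoImplicit false

/-!
# Route `RamifiedSevenEllipticUnits` (rung K7r), value crux `EllipticUnitValueSeven`
# (stmt-BirchSwinnertonDyer-19705), line `rubin-formula`, stub S_B4 `stub_bottomLocalIndexSplitSeven`:
# KERNEL READING of the registered stub, II — the index bookkeeping it consists of, and the four
# arithmetic inputs it silently needs (`--supports 19705`; closes nothing)

Cell `bsd-cm`, seat `bsd-cm-k7r-c2` g4. HONEST FRAMING: nothing here closes the stub, the crux, the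
leaf or any item; BSD is not proved; no named fact is minted; every theorem is `sorry`-free. Companion of
`RamifiedSevenEllipticUnitsBottomLocalIndexSplitReading.lean` (I: what the stub's conclusion forces).

S_B4 = `X12.O11.RamifiedCMBottomLocalIndexSplitAt W p` concludes `D.HasLocalBottomIndexExp (c + m)`, i.e.
(α) `loc_𝔭(𝒪·z(𝟙)) ≤ E(K_𝔭) ⊗ ℤ_p` AND (β) `[E(K_𝔭) ⊗ ℤ_p : tors + loc_𝔭(𝒪·z(𝟙))] = p^{c+m}`, from
`p^c = [S_{p,rel}(E/K) : tors + 𝒪·z(𝟙)]` and `p^m = [E(K_𝔭) ⊗ ℤ_p : tors + loc_𝔭(E(K) ⊗ ℤ_p)]`.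

## What this file proves (all PROVED)

* Part 4 (pure group theory): for additive groups `f : A →+ B`, subgroups `Z` (`𝒪·z`), `M`
  (`E(K) ⊗ ℤ_p`), `G` (`S_{p,rel}(E/K)`) of `A`, `L` (`E(K_𝔭) ⊗ ℤ_p`) of `B` and "torsion" subgroups
  `T_A`, `T_B`: `[L : T_B + f Z] = [G : T_A + Z] · [L : T_B + f M]` GIVEN `M ≤ G ≤ T_A + M`,
  `Z ≤ T_A + M`, `f M ≤ L`, `f T_A ≤ T_B` and `f` injective on `M` modulo torsion
  (`relIndex_sup_map_eq_mul`; second isomorphism theorem + transport along `f`).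
* Part 5: S_B4's identity (β) for a datum, GIVEN (α) and four ARITHMETIC INPUTS, each a recognisable
  statement the stub's binders do not supply — (i) `S_{p,rel}(E/K) ≤ tors + E(K) ⊗ ℤ_p` (`T_pШ(E/K) = 0`
  ∧ relaxed = compact at the bottom), (ii) `𝒪·z(𝟙) ≤ tors + E(K) ⊗ ℤ_p`, (iii) `E(K) ⊗ ℤ_p ≤ S_{p,rel}(E/K)`,
  (iv) `loc_𝔭` injective modulo torsion on `E(K) ⊗ ℤ_p` (`hasLocalBottomIndexExp_of_inputs`).
* Part 6: hence the typed statement S_B4 itself follows from «(α), (i)–(iv) at every frame and datum»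
  (`localIndexSplitAt_of_inputs`; a REDUCTION displayed modulo its hypothesis — it credits nothing).

READING (memo SB4-RECUT.md): (i) is the arithmetic heart (finiteness of `Ш(E/K)[p^∞]` from GZK +
Mordell–Weil + the rank count `rk S_{p,rel}(K, T_pE) = 2` from global duality); (iv) is a `p`-adic
non-degeneracy statement at the ramified prime; (α), (ii), (iii) are carrier lemmas (B1 + `End_K`-
equivariance of the Kummer map + the structure of `E(K_𝔭)`; Kummer classes of global points are Selmer)
not yet in the tree. None is a binder of the registered stub.

References: [BKNO] arXiv:2608.06879v1 Lemma 7.1, Thm. 7.2, §1.4 [BurungaleKobayashiNakamuraOta2026];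
B. Perrin-Riou, Bull. SMF 115 (1987) §0 pp. 401–402 (`0 → E(L) ⊗ ℤ_p → S_p(L) → T_pШ → 0`)
[PerrinRiou1987BSMF]; R. L. Miller, LMS J. Comput. Math. 14 (2011) Def. 1.1 [Miller2011LMS] (bookkeeping).
-/

noncomputable section

open scoped Classical

open WeierstrassCurve NumberField IsDedekindDomain Field
  Literature.NumberTheory.EllipticCurves
  Literature.NumberTheory.EllipticCurves.Rank1Residual
  Literature.NumberTheory.GaloisRepresentations
  Literature.NumberTheory.EllipticCurves.Castella2018
  Literature.NumberTheory.EllipticCurves.BurungaleKobayashiNakamuraOta2026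
  Summit.BirchSwinnertonDyer.Rank1Residual
  Summit.BirchSwinnertonDyer.Rank1Residual.X12

universe u

namespace Summit.BirchSwinnertonDyer.BirchSwinnertonDyer.Theorems.RamifiedSevenEllipticUnits

namespace LocalIndexSplitReading

/-! ## Part 4. The bookkeeping of (β): relative indices along `Z ≤ T + M`, `M ≤ G ≤ T + M`, under a
homomorphism injective on `M` modulo torsion (pure group theory) -/

section Bookkeeping

variable {A B : Type*} [AddCommGroup A] [AddCommGroup B]

/-- Enlarging the ambient group by a subgroup of `H` does not change the relative index of `H`:
`[K + T : H ∩ (K + T)] = [K : H ∩ K]` for `T ≤ H` (second isomorphism theorem, twice).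
[cite: Miller2011LMS, Def. 1.1 (index bookkeeping; shape only)] -/
theorem relIndex_sup_eq_of_le {H K T : AddSubgroup A} (hT : T ≤ H) :
    H.relIndex (K ⊔ T) = H.relIndex K := by
  rw [← AddSubgroup.relIndex_sup_right (K ⊔ T) H, sup_assoc, sup_eq_right.2 hT,
    AddSubgroup.relIndex_sup_right]

/-- **Transport of a relative index along a homomorphism injective modulo torsion.** For
`f : A →+ B`, subgroups `T_A, Z, M ≤ A`, `T_B ≤ B` with `f(T_A) ≤ T_B`, `Z ≤ T_A + M` and `f` injective
on `M` modulo `(T_A, T_B)` (`x ∈ M`, `f x ∈ T_B ⇒ x ∈ T_A`):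
`[T_A + M : T_A + Z] = [f M : (T_B + f Z) ∩ f M]`. [cite: Miller2011LMS, Def. 1.1 (index bookkeeping; shape only)] -/
theorem relIndex_sup_eq_relIndex_map (f : A →+ B) {TA Z M : AddSubgroup A} {TB : AddSubgroup B}
    (hT : TA.map f ≤ TB) (hZ : Z ≤ TA ⊔ M) (hinj : ∀ x ∈ M, f x ∈ TB → x ∈ TA) :
    (TA ⊔ Z).relIndex (TA ⊔ M) = (TB ⊔ Z.map f).relIndex (M.map f) := by
  -- the preimage of `T_B + f Z` meets `T_A + M` in `T_A + Z`
  have hcomap : (TB ⊔ Z.map f).comap f ⊓ (TA ⊔ M) = (TA ⊔ Z) ⊓ (TA ⊔ M) := by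
    apply le_antisymm
    · intro x hx'
      obtain ⟨hx, hxM⟩ := AddSubgroup.mem_inf.1 hx'
      refine AddSubgroup.mem_inf.2 ⟨?_, hxM⟩
      replace hx := AddSubgroup.mem_comap.1 hx
      obtain ⟨t, ht, μ, hμ, rfl⟩ := AddSubgroup.mem_sup.1 hxM
      obtain ⟨tb, htb, w, hw, hsum⟩ := AddSubgroup.mem_sup.1 hx
      obtain ⟨ζ, hζ, rfl⟩ := AddSubgroup.mem_map.1 hw
      obtain ⟨t', ht', μ', hμ', rfl⟩ := AddSubgroup.mem_sup.1 (hZ hζ)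
      -- `f (μ - μ') ∈ T_B`, hence `μ - μ' ∈ T_A`
      have hdiff : f (μ - μ') ∈ TB := by
        have hsum' := hsum
        rw [map_add, map_add] at hsum'
        -- hsum' : tb + (f t' + f μ') = f t + f μ
        have e : f (μ - μ') = tb + f t' - f t := by
          rw [map_sub]
          calc f μ - f μ' = (f t + f μ) - f t - f μ' := by abel
            _ = (tb + (f t' + f μ')) - f t - f μ' := by rw [hsum']
            _ = tb + f t' - f t := by abel
        rw [e]
        exact TB.sub_mem (TB.add_mem htb (hT ⟨t', ht', rfl⟩)) (hT ⟨t, ht, rfl⟩)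
      have hμμ' : μ - μ' ∈ TA := hinj _ (M.sub_mem hμ hμ') hdiff
      have : t + μ = (t + (μ - μ') - t') + (t' + μ') := by abel
      rw [this]
      exact AddSubgroup.add_mem _
        (AddSubgroup.mem_sup_left (TA.sub_mem (TA.add_mem ht hμμ') ht'))
        (AddSubgroup.mem_sup_right hζ)
    · intro x hx'
      obtain ⟨hx, hxM⟩ := AddSubgroup.mem_inf.1 hx'
      refine AddSubgroup.mem_inf.2 ⟨AddSubgroup.mem_comap.2 ?_, hxM⟩
      obtain ⟨t, ht, ζ, hζ, rfl⟩ := AddSubgroup.mem_sup.1 hx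
      rw [map_add]
      exact AddSubgroup.add_mem _ (AddSubgroup.mem_sup_left (hT ⟨t, ht, rfl⟩))
        (AddSubgroup.mem_sup_right ⟨ζ, hζ, rfl⟩)
  calc (TA ⊔ Z).relIndex (TA ⊔ M)
      = ((TA ⊔ Z) ⊓ (TA ⊔ M)).relIndex (TA ⊔ M) := (AddSubgroup.inf_relIndex_right _ _).symm
    _ = ((TB ⊔ Z.map f).comap f ⊓ (TA ⊔ M)).relIndex (TA ⊔ M) := by rw [hcomap]
    _ = ((TB ⊔ Z.map f).comap f).relIndex (TA ⊔ M) := AddSubgroup.inf_relIndex_right _ _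
    _ = (TB ⊔ Z.map f).relIndex ((TA ⊔ M).map f) := AddSubgroup.relIndex_comap _ _ _
    _ = (TB ⊔ Z.map f).relIndex (M.map f ⊔ TA.map f) := by rw [AddSubgroup.map_sup, sup_comm (TA.map f)]
    _ = (TB ⊔ Z.map f).relIndex (M.map f) :=
        relIndex_sup_eq_of_le (hT.trans le_sup_left)

/-- **The index bookkeeping behind S_B4 (β)**: `[L : (T_B + f Z) ∩ L] = [G : (T_A + Z) ∩ G] · [L : (T_B + f M) ∩ L]`
for `f : A →+ B` and subgroups with `f(T_A) ≤ T_B`, `M ≤ G ≤ T_A + M`, `Z ≤ T_A + M`, `f M ≤ L`, and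
`f` injective on `M` modulo torsion. Intended reading: `A = ∏_k H¹(K, E[p^k])`, `B` its local twin at
`𝔭`, `f = loc_𝔭`, `T` = torsion, `Z = 𝒪·z(𝟙)`, `M = E(K) ⊗ ℤ_p` (Kummer span), `G = S_{p,rel}(E/K)`,
`L = E(K_𝔭) ⊗ ℤ_p`: then the three indices are `p^{λ₀}`, `p^c`, `p^{m_loc}`. [cite: Miller2011LMS, Def. 1.1 (index bookkeeping; shape only)] -/
theorem relIndex_sup_map_eq_mul (f : A →+ B) {TA Z M G : AddSubgroup A} {TB L : AddSubgroup B}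
    (hT : TA.map f ≤ TB) (hMG : M ≤ G) (hG : G ≤ TA ⊔ M) (hZ : Z ≤ TA ⊔ M) (hML : M.map f ≤ L)
    (hinj : ∀ x ∈ M, f x ∈ TB → x ∈ TA) :
    (TB ⊔ Z.map f).relIndex L = (TA ⊔ Z).relIndex G * (TB ⊔ M.map f).relIndex L := by
  have hZB : TB ⊔ Z.map f ≤ TB ⊔ M.map f := by
    refine sup_le le_sup_left ((AddSubgroup.map_mono hZ).trans ?_)
    rw [AddSubgroup.map_sup]
    exact sup_le (hT.trans le_sup_left) le_sup_right
  -- (1) split `[L : T_B + fZ]` along `T_B + fZ ≤ T_B + fM`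
  have h1 : (TB ⊔ Z.map f).relIndex ((TB ⊔ M.map f) ⊓ L) * (TB ⊔ M.map f).relIndex L =
      (TB ⊔ Z.map f).relIndex L := by
    rw [AddSubgroup.relIndex_inf_mul_relIndex, inf_eq_left.2 hZB]
  -- (2) `[(T_B + fM) ∩ L : …] = [fM : …]` because `fM ≤ L` represents every class modulo `T_B`
  have h2 : (TB ⊔ Z.map f).relIndex ((TB ⊔ M.map f) ⊓ L) = (TB ⊔ Z.map f).relIndex (M.map f) := by
    have e : (TB ⊔ M.map f) ⊓ L ⊔ TB = M.map f ⊔ TB :=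
      le_antisymm (sup_le (inf_le_left.trans (by rw [sup_comm])) le_sup_right)
        (sup_le (le_sup_of_le_left (le_inf le_sup_right hML)) le_sup_right)
    rw [← relIndex_sup_eq_of_le (K := (TB ⊔ M.map f) ⊓ L) (le_sup_left : TB ≤ TB ⊔ Z.map f), e,
      relIndex_sup_eq_of_le (K := M.map f) (le_sup_left : TB ≤ TB ⊔ Z.map f)]
  -- (3) transport to `A`, (4) replace `T_A + M` by `G`
  have h3 := relIndex_sup_eq_relIndex_map f hT hZ hinj
  have h4 : (TA ⊔ Z).relIndex G = (TA ⊔ Z).relIndex (TA ⊔ M) := by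
    have e : G ⊔ TA = M ⊔ TA :=
      le_antisymm (sup_le (hG.trans (by rw [sup_comm])) le_sup_right)
        (sup_le (hMG.trans le_sup_left) le_sup_right)
    rw [← relIndex_sup_eq_of_le (K := G) (le_sup_left : TA ≤ TA ⊔ Z), e, sup_comm M TA]
  rw [← h1, h2, ← h3, h4]

end Bookkeeping

/-! ## Part 5. S_B4's identity (β) for a datum, GIVEN (α) and the four arithmetic inputs -/

section Inputs

variable {A B : Type*} [AddCommGroup A] [AddCommGroup B]

/-- A homomorphism maps torsion into torsion. [cite: Miller2011LMS, Def. 1.1 (bookkeeping; shape only)] -/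
theorem map_torsion_le (f : A →+ B) : (AddCommGroup.torsion A).map f ≤ AddCommGroup.torsion B := by
  rintro _ ⟨x, hx, rfl⟩
  exact f.isOfFinAddOrder hx

variable {W : WeierstrassCurve ℚ} [W.IsElliptic] {p : ℕ} [Fact p.Prime]
  {K : Type} [Field K] [NumberField K] {𝔭 : HeightOneSpectrum (𝓞 K)}
  {κ : ZpExtension K p} {γ : absoluteGaloisGroup K}
  {ι : PadicAlgCl p ≃+* ℂ} {φ : HeckeCharacter K} {Ω : ℂ} {𝓔 : AcDualExpSystem W p K 𝔭 κ ι}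

/-- **S_B4 (β) from named inputs.** For a datum `D` with global bottom index exponent `c`
(`p^c = [S_{p,rel}(E/K) : tors + 𝒪·z(𝟙)]`) and a local Mordell–Weil index exponent `m`
(`p^m = [E(K_𝔭) ⊗ ℤ_p : tors + loc_𝔭(E(K) ⊗ ℤ_p)]`), the local bottom index exponent is `c + m` —
`D.HasLocalBottomIndexExp (c + m)` — PROVIDED:
(α) `loc_𝔭(𝒪·z(𝟙)) ≤ E(K_𝔭) ⊗ ℤ_p` (the bottom class and its `End_K`-multiples are local Kummer classes:
B1 + `End_K`-equivariance of the Kummer map + the structure of `E(K_𝔭)`; binder `hα`);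
(i) `S_{p,rel}(E/K) ≤ tors + E(K) ⊗ ℤ_p` (`T_pШ(E/K) = 0` AND relaxed = compact at the bottom — in
analytic rank one: finiteness of `Ш(E/K)[p^∞]` (GZK), Mordell–Weil, and the rank count
`rk S_{p,rel} = 2` from global duality; binder `hG`);
(ii) `𝒪·z(𝟙) ≤ tors + E(K) ⊗ ℤ_p` (⟸ (i) once `𝒪·z(𝟙) ≤ S_{p,rel}`, i.e. `End_K`-stability of the
relaxed Selmer group; binder `hZ`);
(iii) `E(K) ⊗ ℤ_p ≤ S_{p,rel}(E/K)` (Kummer classes of global points are Selmer; binder `hMG`);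
(iv) `loc_𝔭` is injective on `E(K) ⊗ ℤ_p` modulo torsion (a `p`-adic non-degeneracy / rank statement at
the ramified prime; binder `hinj`).
None of (α), (i)–(iv) is among the binders of the registered stub; (i) and (iv) are the arithmetic
content, (ii)/(iii)/(α) are carrier lemmas not yet in the tree. The proof is Part 4's bookkeeping with
`f = loc_𝔭`, `f(tors) ≤ tors` (`map_torsion_le`) and `loc_𝔭(E(K) ⊗ ℤ_p) ≤ E(K_𝔭) ⊗ ℤ_p`
(`map_localTorsionResPi_mordellWeilKummerSpan_le`, p449855).
[cite: BurungaleKobayashiNakamuraOta2026, Lemma 7.1, Thm. 7.2 and §1.4 (arXiv:2608.06879 pp. 8, 40–41) (claim; preprint; shape only)]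
[cite: PerrinRiou1987BSMF, §0 pp. 401–402 (the descent sequence `0 → E(L) ⊗ ℤ_p → S_p(L) → T_pШ → 0`)] -/
theorem hasLocalBottomIndexExp_of_inputs (D : EllipticUnitClassData W p K 𝔭 κ γ ι φ Ω 𝓔) {c m : ℕ}
    (hc : D.HasBottomIndexExp c) (hm : HasBottomLocalMordellWeilIndexExp W p K 𝔭 κ m)
    (hα : (W.baseChange K).localEndSpanOfEmb (closureEmb (K := K) (𝔭.adicCompletion K)) p
        (κ.layerSubgroup 0) (D.z 0) ≤
      (W.baseChange K).localKummerCompactOfEmb (closureEmb (K := K) (𝔭.adicCompletion K)) p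
        (κ.layerSubgroup 0))
    (hG : (W.baseChange K).relaxedCompactSelmerOver (κ.layerSubgroup 0) p {𝔭} ≤
      AddCommGroup.torsion ((W.baseChange K).torsionH1Pi p (κ.layerSubgroup 0)) ⊔
        (W.baseChange K).mordellWeilKummerSpan p (κ.layerSubgroup 0))
    (hZ : (W.baseChange K).endSpan p (κ.layerSubgroup 0) (D.z 0) ≤
      AddCommGroup.torsion ((W.baseChange K).torsionH1Pi p (κ.layerSubgroup 0)) ⊔
        (W.baseChange K).mordellWeilKummerSpan p (κ.layerSubgroup 0))
    (hMG : (W.baseChange K).mordellWeilKummerSpan p (κ.layerSubgroup 0) ≤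
      (W.baseChange K).relaxedCompactSelmerOver (κ.layerSubgroup 0) p {𝔭})
    (hinj : ∀ x ∈ (W.baseChange K).mordellWeilKummerSpan p (κ.layerSubgroup 0),
      (W.baseChange K).localTorsionResPi (closureEmb (K := K) (𝔭.adicCompletion K)) p
          (κ.layerSubgroup 0) x ∈
        AddCommGroup.torsion (((W.baseChange K).baseChange (𝔭.adicCompletion K)).torsionH1Pi p
          (localSubgroupOfEmb (κ.layerSubgroup 0) (closureEmb (K := K) (𝔭.adicCompletion K)))) →
      x ∈ AddCommGroup.torsion ((W.baseChange K).torsionH1Pi p (κ.layerSubgroup 0))) :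
    D.HasLocalBottomIndexExp (c + m) := by
  refine ⟨hα, ?_⟩
  have hc' := hc
  have hm' := hm
  unfold EllipticUnitClassData.HasBottomIndexExp at hc'
  unfold HasBottomLocalMordellWeilIndexExp WeierstrassCurve.HasLocalMordellWeilIndexExpOfEmb at hm'
  rw [pow_add, ← hc', ← hm', WeierstrassCurve.localEndSpanOfEmb]
  exact relIndex_sup_map_eq_mul _ (map_torsion_le _) hMG hG hZ
    ((W.baseChange K).map_localTorsionResPi_mordellWeilKummerSpan_le _ p _) hinj

/-- **The re-cut S_B4′ («identity only, `∀ λ₀`-form») PROVED modulo the four inputs**: for a datum with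
global exponent `c`, any local bottom index exponent `l` (whose existence supplies (α)) and any local
Mordell–Weil exponent `m`, the inputs (i)–(iv) give `l = c + m` (previous theorem + uniqueness of the
local exponent, `hasLocalBottomIndexExp_unique`). This is the statement the seat proposes to register in
place of S_B4 (memo SB4-RECUT.md §2), with (i)–(iv) as its honest residue.
[cite: BurungaleKobayashiNakamuraOta2026, Thm. 7.2 and §1.4 (arXiv:2608.06879 pp. 8, 41) (claim; preprint; shape only)] -/
theorem localBottomIndexExp_eq_of_inputs (D : EllipticUnitClassData W p K 𝔭 κ γ ι φ Ω 𝓔) {c m l : ℕ}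
    (hc : D.HasBottomIndexExp c) (hm : HasBottomLocalMordellWeilIndexExp W p K 𝔭 κ m)
    (hl : D.HasLocalBottomIndexExp l)
    (hG : (W.baseChange K).relaxedCompactSelmerOver (κ.layerSubgroup 0) p {𝔭} ≤
      AddCommGroup.torsion ((W.baseChange K).torsionH1Pi p (κ.layerSubgroup 0)) ⊔
        (W.baseChange K).mordellWeilKummerSpan p (κ.layerSubgroup 0))
    (hZ : (W.baseChange K).endSpan p (κ.layerSubgroup 0) (D.z 0) ≤
      AddCommGroup.torsion ((W.baseChange K).torsionH1Pi p (κ.layerSubgroup 0)) ⊔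
        (W.baseChange K).mordellWeilKummerSpan p (κ.layerSubgroup 0))
    (hMG : (W.baseChange K).mordellWeilKummerSpan p (κ.layerSubgroup 0) ≤
      (W.baseChange K).relaxedCompactSelmerOver (κ.layerSubgroup 0) p {𝔭})
    (hinj : ∀ x ∈ (W.baseChange K).mordellWeilKummerSpan p (κ.layerSubgroup 0),
      (W.baseChange K).localTorsionResPi (closureEmb (K := K) (𝔭.adicCompletion K)) p
          (κ.layerSubgroup 0) x ∈
        AddCommGroup.torsion (((W.baseChange K).baseChange (𝔭.adicCompletion K)).torsionH1Pi p
          (localSubgroupOfEmb (κ.layerSubgroup 0) (closureEmb (K := K) (𝔭.adicCompletion K)))) →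
      x ∈ AddCommGroup.torsion ((W.baseChange K).torsionH1Pi p (κ.layerSubgroup 0))) :
    l = c + m :=
  D.hasLocalBottomIndexExp_unique hl (hasLocalBottomIndexExp_of_inputs D hc hm hl.1 hG hZ hMG hinj)

end Inputs

/-! ## Part 6. The registered stub REDUCED to (α) + the four inputs, frame by frame -/

section Reduction

variable {W : WeierstrassCurve ℚ} [W.IsElliptic] [W.IsGloballyMinimal] {p : ℕ} [Fact p.Prime]

omit [W.IsGloballyMinimal] in
/-- **S_B4 from its inputs, at the level of the typed statement**: if at every analytic-rank-one frame,
anticyclotomic tower and datum with a global bottom index exponent `c` and the IMC identity the five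
inputs (α), (i)–(iv) of `hasLocalBottomIndexExp_of_inputs` hold, then
`X12.O11.RamifiedCMBottomLocalIndexSplitAt W p`. This is the honest content of the registered stub: a
re-cut should file (i) and (iv) (arithmetic) and (α)/(ii)/(iii) (carrier lemmas) instead of S_B4.
[cite: BurungaleKobayashiNakamuraOta2026, Lemma 7.1, Thm. 7.2 and §1.4 (arXiv:2608.06879 pp. 8, 40–41) (claim; preprint; shape only)] -/
theorem localIndexSplitAt_of_inputs
    (hin : ∀ (K : Type) [Field K] [NumberField K] (𝔭 : HeightOneSpectrum (𝓞 K))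
      (W' : WeierstrassCurve ℚ) [W'.IsElliptic] [W'.IsGloballyMinimal] (C : VariableChange ℚ),
      O11.IsFrame W p K 𝔭 W' C → W.analyticRank = 1 →
      ∀ (κ : ZpExtension K p), κ.IsAnticyclotomic →
        ∀ (γ : absoluteGaloisGroup K) [Fact (κ.IsTopGenerator γ)]
          (ι : PadicAlgCl p ≃+* ℂ) (φ : HeckeCharacter K) (Ω : ℂ) (𝓔 : AcDualExpSystem W p K 𝔭 κ ι)
          (D : EllipticUnitClassData W p K 𝔭 κ γ ι φ Ω 𝓔) (c : ℕ), D.HasBottomIndexExp c →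
          (∀ (n₀ : ℕ), AcSelmer.XAc.HasCharValuationAt (W.baseChange K) p κ 𝔭 ∅ γ n₀ →
            Finite {x : AcSelmer.XAc (W.baseChange K) p κ 𝔭 ∅ γ //
              (PowerSeries.X : IwasawaAlgebra p) • x = 0} →
            (n₀ : ℤ) + padicValNat p (Nat.card {x : AcSelmer.XAc (W.baseChange K) p κ 𝔭 ∅ γ //
                (PowerSeries.X : IwasawaAlgebra p) • x = 0}) = c) →
          ((W.baseChange K).localEndSpanOfEmb (closureEmb (K := K) (𝔭.adicCompletion K)) p
              (κ.layerSubgroup 0) (D.z 0) ≤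
            (W.baseChange K).localKummerCompactOfEmb (closureEmb (K := K) (𝔭.adicCompletion K)) p
              (κ.layerSubgroup 0)) ∧
          ((W.baseChange K).relaxedCompactSelmerOver (κ.layerSubgroup 0) p {𝔭} ≤
            AddCommGroup.torsion ((W.baseChange K).torsionH1Pi p (κ.layerSubgroup 0)) ⊔
              (W.baseChange K).mordellWeilKummerSpan p (κ.layerSubgroup 0)) ∧
          ((W.baseChange K).endSpan p (κ.layerSubgroup 0) (D.z 0) ≤
            AddCommGroup.torsion ((W.baseChange K).torsionH1Pi p (κ.layerSubgroup 0)) ⊔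
              (W.baseChange K).mordellWeilKummerSpan p (κ.layerSubgroup 0)) ∧
          ((W.baseChange K).mordellWeilKummerSpan p (κ.layerSubgroup 0) ≤
            (W.baseChange K).relaxedCompactSelmerOver (κ.layerSubgroup 0) p {𝔭}) ∧
          (∀ x ∈ (W.baseChange K).mordellWeilKummerSpan p (κ.layerSubgroup 0),
            (W.baseChange K).localTorsionResPi (closureEmb (K := K) (𝔭.adicCompletion K)) p
                (κ.layerSubgroup 0) x ∈
              AddCommGroup.torsion (((W.baseChange K).baseChange (𝔭.adicCompletion K)).torsionH1Pi p
                (localSubgroupOfEmb (κ.layerSubgroup 0)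
                  (closureEmb (K := K) (𝔭.adicCompletion K)))) →
            x ∈ AddCommGroup.torsion ((W.baseChange K).torsionH1Pi p (κ.layerSubgroup 0)))) :
    O11.RamifiedCMBottomLocalIndexSplitAt W p := by
  intro K _ _ 𝔭 W' _ _ C hF hr κ hκ γ _ ι φ Ω 𝓔 D c hc himc m hm
  obtain ⟨hα, hG, hZ, hMG, hinj⟩ := hin K 𝔭 W' C hF hr κ hκ γ ι φ Ω 𝓔 D c hc himc
  exact hasLocalBottomIndexExp_of_inputs D hc hm hα hG hZ hMG hinj

end Reduction

end LocalIndexSplitReading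

end Summit.BirchSwinnertonDyer.BirchSwinnertonDyer.Theorems.RamifiedSevenEllipticUnits

end
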